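-- PORT-REPAIR carch-1-g56 2026-08-21T20:32Z: p301846 bounced 2026-08-21T19:46:21Z «lint: declares custom syntax/macros/elaborators (line 53)» — the RUN-81 source's file-local tactic macro `cplx_ring` (6-line block) DELETED and its 16 use(s) on 10 line(s) INLINED with the per-site pruned tactic (carch-1 g54/g55 rendering, hub 0 warnings); nothing else changed: line 1, imports, docstrings, statements byte-identical to port/staging.
/-
Origin: expansion seat `prover-pub-hodgecm-mc-carch-1-g4-0`, handover #CA28 2026-08-20T07:35Z md5 9af3894874f1 (605 l., 74 decls; NEW additive leaf; imports installed vendored twins Geometry/ComplexHyperbolic/UnitBallIsotropy + UnitBallIsotropyBlock + UnitBallU21Borel + RepresentationTheory/CompactGroups/CircleCharacters only; RUN 44; drop-alone; cert certs/ax-ArchU21Characters-9af3894874f1.log: rc 0 / 31 s / 0 warnings / 74/74 trio over the PKG .lake farm after RUN-43 GO #2) (`HOME/mc/pub-hodgecm-mc-carch-1/pkg44/HodgeCM/Model/ArchU21Characters.lean`, md5 9af3894874f1, 607 lines);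
landed by the second packager p2 gen 4 (p2-g4) in gate run 44 as `HodgeCM/Model/ArchU21Characters.lean` (verbatim).
-/
/-
Copyright (c) 2026. Released under Apache 2.0 license as described in the file LICENSE.
Cell pub-hodgecm, MODEL layer (construction prover mc-carch-1, gen 4), BINDER-OWNERS row 12 `C`, junction (C-Λ):
abelian characters of `U(2,1)` on the maximal compact `K = U(2) × U(1)` factor through `det`.
-/
import Literature.Geometry.ComplexHyperbolic.UnitBallIsotropy
import Literature.Geometry.ComplexHyperbolic.UnitBallIsotropyBlock
import Literature.Geometry.ComplexHyperbolic.UnitBallU21Borel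
import Literature.RepresentationTheory.CompactGroups.CircleCharacters

/-!
# Every homomorphism from `U(2,1)` to an abelian group factors through `det` on `K = U(2) × U(1)`

For the tree's model `BallModel.U21 = {g ∈ GL₃(ℂ) : gᴴ J g = J}`, `J = diag(1,1,-1)`, and ANY group homomorphism
`χ : U21 →* M` into a commutative group (no continuity):

* § 1–3 the copy of `SU(1,1)` in the `(0,2)`-plane: `hypMat α β = (α 0 β; 0 1 0; β̄ 0 ᾱ)` (`ᾱα − β̄β = 1`), its one-parameter
  unipotent subgroups `uni x` (`α = 1 + ix/2, β = −ix/2`), `uniBar s` (`α = 1 − is/2, β = −is/2`) and the boost `bst`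
  (`α = 5/4, β = 3/4`, = `boostMat`); the boost CONJUGATES `uni y ↦ uni (4y)`, `uniBar y ↦ uniBar (y/4)`, so every `uni x`,
  `uniBar s` is a quotient of conjugates and **`χ (uni x) = χ (uniBar s) = 1`** (`map_uni`, `map_uniBar`);
* § 4 the compact torus elements `torT z = diag(z, 1, z̄)` (`|z| = 1`) are products `uni p · uniBar y · uni p` (the Cayley image of
  `rotation = unipotent · unipotent · unipotent` in `SL₂(ℝ)`), whence **`χ (diag(z,1,z̄)) = 1`** (`map_torT`) and, conjugating by the
  coordinate swap, **`χ (diag(1,z,z̄)) = 1`** (`map_torT'`);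
* § 5 on the block subgroup `blockU : U(2) × U(1) →* U(2,1)` (`UnitBallIsotropyBlock`): `χ (diag(p, p̄, 1)) = 1`, `χ` kills the real
  rotations `diag(R(x,y), 1)` (conjugate by a fixed unitary to `diag(z, z̄, 1)`), hence all of `SU(2) × 1` (Euler factorisation
  `s = diag(p,p̄) R diag(q,q̄)`), and finally **`map_blockU_eq : χ (blockU (A, d)) = χ (diag(det A · d, 1, 1))`** — on `K` every
  abelian character of `U(2,1)` is a function of `det`;
* § 6 with continuity along `z ↦ diag(z, 1, 1)` (the circle): **`exists_zpow_of_continuous`** — `χ (diag(A, d)) = (det A · d)^ℓ` for ONE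
  `ℓ : ℤ` (the twin `CircleChar.existsUnique_zpow_complex`, [BröckerTomDieck1985, II (8.1)]).

§§ 1–5 purely algebraic (matrix identities over `ℂ`); the style is that of the twin `JunctionFactorisationExpP.map_expP_eq_one`.  Used by the
C lane for (Λ-v₁) of the junction (C-Λ): the see-saw discrepancy `λ_V′` pulled back along `archSectionFrameOf V : U21 →* U(V)(L⁺ ⊗ ℝ)`
is `(det A · d)^ℓ` on `Stab(x₀)`.  0 records, 0 `def … : Prop`, nothing cited as a hypothesis.
-/

set_option autoImplicit false

noncomputable section

open scoped Matrix
open ComplexConjugate Complex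
open Literature.Geometry.ComplexHyperbolic Literature.Geometry.ComplexHyperbolic.BallModel
open Literature.NumberTheory.Automorphic.U21 (K21 matA sclD)

namespace HodgeCM.Model.U21Char

/-! ## § 1 `SU(1,1)` in the `(0,2)`-plane -/

/-- `(α 0 β; 0 1 0; β̄ 0 ᾱ)`. -/
def hypMat (α β : ℂ) : Matrix (Fin 3) (Fin 3) ℂ := !![α, 0, β; 0, 1, 0; conj β, 0, conj α]

/-- it preserves `J` when `ᾱα − β̄β = 1`. -/
theorem hypMat_mem {α β : ℂ} (h : conj α * α - conj β * β = 1) : (hypMat α β)ᴴ * BallModel.J * hypMat α β = BallModel.J := by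
  ext i j
  fin_cases i <;> fin_cases j <;>
    simp [hypMat, BallModel.J, Matrix.mul_apply, Fin.sum_univ_three, Matrix.conjTranspose_apply, Matrix.diagonal_apply] <;>
    first | linear_combination h | linear_combination -h | ring1

/-- the product of two such matrices. -/
theorem hypMat_mul (α β γ δ : ℂ) :
    hypMat α β * hypMat γ δ = hypMat (α * γ + β * conj δ) (α * δ + β * conj γ) := by
  ext i j
  fin_cases i <;> fin_cases j <;>
    simp [hypMat, Matrix.mul_apply, Fin.sum_univ_three] <;> ring

/-- `hypMat 1 0 = 1`. -/
theorem hypMat_one : hypMat 1 0 = 1 := by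
  ext i j
  fin_cases i <;> fin_cases j <;> simp [hypMat]

/-- the element of `U(2,1)`. -/
def hyp (α β : ℂ) (h : conj α * α - conj β * β = 1) : U21 := mkU21 (hypMat α β) (hypMat_mem h)

/-- (Ported verbatim from the HodgeCMPerL package; no docstring in the source.) -/
@[simp] theorem mat_hyp (α β : ℂ) (h : conj α * α - conj β * β = 1) : mat (hyp α β h) = hypMat α β := rfl

/-- (Ported verbatim from the HodgeCMPerL package; no docstring in the source.) -/
theorem U21_eq_of_mat_eq {g g' : U21} (h : mat g = mat g') : g = g' := Subtype.ext (Units.ext h)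

/-- (Ported verbatim from the HodgeCMPerL package; no docstring in the source.) -/
theorem hyp_mul (α β γ δ : ℂ) (h : conj α * α - conj β * β = 1) (h' : conj γ * γ - conj δ * δ = 1)
    (h'' : conj (α * γ + β * conj δ) * (α * γ + β * conj δ) - conj (α * δ + β * conj γ) * (α * δ + β * conj γ) = 1) :
    hyp α β h * hyp γ δ h' = hyp (α * γ + β * conj δ) (α * δ + β * conj γ) h'' :=
  U21_eq_of_mat_eq (by rw [mat_mul, mat_hyp, mat_hyp, mat_hyp, hypMat_mul])

/-- (Ported verbatim from the HodgeCMPerL package; no docstring in the source.) -/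
theorem hyp_congr {α β γ δ : ℂ} (h : conj α * α - conj β * β = 1) (h' : conj γ * γ - conj δ * δ = 1)
    (hα : α = γ) (hβ : β = δ) : hyp α β h = hyp γ δ h' := by
  subst hα hβ; rfl

/-! ## § 2 Unipotents and the boost -/

/-- (Ported verbatim from the HodgeCMPerL package; no docstring in the source.) -/
theorem uni_rel (x : ℝ) : conj (1 + I * x / 2) * (1 + I * x / 2) - conj (-(I * x / 2)) * (-(I * x / 2)) = (1 : ℂ) := by
  simp only [map_add, map_neg, map_mul, map_div₀, map_one, conj_I, conj_ofReal, map_ofNat]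
  ring

/-- (Ported verbatim from the HodgeCMPerL package; no docstring in the source.) -/
theorem uniBar_rel (s : ℝ) : conj (1 - I * s / 2) * (1 - I * s / 2) - conj (-(I * s / 2)) * (-(I * s / 2)) = (1 : ℂ) := by
  simp only [map_sub, map_neg, map_mul, map_div₀, map_one, conj_I, conj_ofReal, map_ofNat]
  ring

/-- the unipotent `n(x)`, `x ∈ ℝ` (Cayley image of `(1 x; 0 1)`). -/
def uni (x : ℝ) : U21 := hyp (1 + I * x / 2) (-(I * x / 2)) (uni_rel x)

/-- the opposite unipotent `n̄(s)`, `s ∈ ℝ` (Cayley image of `(1 0; s 1)`). -/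
def uniBar (s : ℝ) : U21 := hyp (1 - I * s / 2) (-(I * s / 2)) (uniBar_rel s)

/-- (Ported verbatim from the HodgeCMPerL package; no docstring in the source.) -/
theorem bst_rel : conj (5 / 4 : ℂ) * (5 / 4) - conj (3 / 4 : ℂ) * (3 / 4) = 1 := by
  have h5 : conj (5 / 4 : ℂ) = 5 / 4 := by
    rw [map_div₀, map_ofNat, map_ofNat]
  have h3 : conj (3 / 4 : ℂ) = 3 / 4 := by
    rw [map_div₀, map_ofNat, map_ofNat]
  rw [h5, h3]; norm_num

/-- the boost `a = (5/4 0 3/4; 0 1 0; 3/4 0 5/4)` (Cayley image of `diag(2, 1/2)`). -/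
def bst : U21 := hyp (5 / 4) (3 / 4) bst_rel

/-- (Ported verbatim from the HodgeCMPerL package; no docstring in the source.) -/
theorem hypMat_congr {α β γ δ : ℂ} (hα : α = γ) (hβ : β = δ) : hypMat α β = hypMat γ δ := by rw [hα, hβ]

/-- (Ported verbatim from the HodgeCMPerL package; no docstring in the source.) -/
theorem uni_add (x y : ℝ) : uni x * uni y = uni (x + y) :=
  U21_eq_of_mat_eq (by
    rw [mat_mul, uni, uni, uni, mat_hyp, mat_hyp, mat_hyp, hypMat_mul]
    exact hypMat_congr (by ((try simp only [map_neg, map_mul, map_div₀, map_ofNat, Complex.conj_I, Complex.conj_ofReal, Complex.ofReal_add]); ring1)) (by ((try simp only [map_add, map_mul, map_div₀, map_one, map_ofNat, Complex.conj_I, Complex.conj_ofReal, Complex.ofReal_add]); ring1)))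

/-- (Ported verbatim from the HodgeCMPerL package; no docstring in the source.) -/
theorem uniBar_add (s t : ℝ) : uniBar s * uniBar t = uniBar (s + t) :=
  U21_eq_of_mat_eq (by
    rw [mat_mul, uniBar, uniBar, uniBar, mat_hyp, mat_hyp, mat_hyp, hypMat_mul]
    exact hypMat_congr (by ((try simp only [map_neg, map_mul, map_div₀, map_ofNat, Complex.conj_I, Complex.conj_ofReal, Complex.ofReal_add]); ring1)) (by ((try simp only [map_sub, map_mul, map_div₀, map_one, map_ofNat, Complex.conj_I, Complex.conj_ofReal, Complex.ofReal_add]); ring1)))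

/-- (Ported verbatim from the HodgeCMPerL package; no docstring in the source.) -/
theorem uni_zero : uni 0 = 1 :=
  U21_eq_of_mat_eq (by
    rw [uni, mat_hyp, mat_one, ← hypMat_one]
    exact hypMat_congr (by ((try simp only [Complex.ofReal_zero]); ring1)) (by ((try simp only [Complex.ofReal_zero]); ring1)))

/-- (Ported verbatim from the HodgeCMPerL package; no docstring in the source.) -/
theorem uniBar_zero : uniBar 0 = 1 :=
  U21_eq_of_mat_eq (by
    rw [uniBar, mat_hyp, mat_one, ← hypMat_one]
    exact hypMat_congr (by ((try simp only [Complex.ofReal_zero]); ring1)) (by ((try simp only [Complex.ofReal_zero]); ring1)))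

/-- (Ported verbatim from the HodgeCMPerL package; no docstring in the source.) -/
theorem conj_five_fourths : conj (5 / 4 : ℂ) = 5 / 4 := by rw [map_div₀, map_ofNat, map_ofNat]

/-- (Ported verbatim from the HodgeCMPerL package; no docstring in the source.) -/
theorem conj_three_fourths : conj (3 / 4 : ℂ) = 3 / 4 := by rw [map_div₀, map_ofNat, map_ofNat]

/-- conjugation by the boost dilates the unipotent: `a · n(y) = n(4y) · a`. -/
theorem bst_mul_uni (y : ℝ) : bst * uni y = uni (4 * y) * bst :=
  U21_eq_of_mat_eq (by
    rw [mat_mul, mat_mul, bst, uni, uni, mat_hyp, mat_hyp, mat_hyp, hypMat_mul, hypMat_mul]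
    exact hypMat_congr (by rw [conj_three_fourths]; ((try simp only [map_neg, map_mul, map_div₀, map_ofNat, Complex.conj_I, Complex.conj_ofReal, Complex.ofReal_mul, Complex.ofReal_ofNat]); ring1)) (by rw [conj_five_fourths]; ((try simp only [map_add, map_mul, map_div₀, map_one, map_ofNat, Complex.conj_I, Complex.conj_ofReal, Complex.ofReal_mul, Complex.ofReal_ofNat]); ring1)))

/-- … and contracts the opposite one: `a · n̄(4y) = n̄(y) · a`. -/
theorem bst_mul_uniBar (y : ℝ) : bst * uniBar (4 * y) = uniBar y * bst :=
  U21_eq_of_mat_eq (by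
    rw [mat_mul, mat_mul, bst, uniBar, uniBar, mat_hyp, mat_hyp, mat_hyp, hypMat_mul, hypMat_mul]
    exact hypMat_congr (by rw [conj_three_fourths]; ((try simp only [map_neg, map_mul, map_div₀, map_ofNat, Complex.conj_I, Complex.conj_ofReal, Complex.ofReal_mul, Complex.ofReal_ofNat]); ring1)) (by rw [conj_five_fourths]; ((try simp only [map_sub, map_mul, map_div₀, map_one, map_ofNat, Complex.conj_I, Complex.conj_ofReal, Complex.ofReal_mul, Complex.ofReal_ofNat]); ring1)))

/-! ## § 3 Abelian characters kill the unipotents -/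

section Char

variable {M : Type*} [CommGroup M] (χ : U21 →* M)

/-- **`χ (n(x)) = 1`** for every homomorphism to a commutative group. -/
theorem map_uni (x : ℝ) : χ (uni x) = 1 := by
  have key : ∀ y : ℝ, χ (uni y) = χ (uni (4 * y)) := fun y => by
    have h := congrArg χ (bst_mul_uni y)
    rw [map_mul, map_mul, mul_comm (χ (uni (4 * y)))] at h
    exact mul_left_cancel h
  have h3 : ∀ y : ℝ, χ (uni (3 * y)) = 1 := fun y => by
    have e : uni (4 * y) = uni y * uni (3 * y) := by rw [uni_add]; ring_nf
    have h := key y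
    rw [e, map_mul] at h
    exact mul_left_cancel (h.symm.trans (mul_one _).symm)
  simpa [show 3 * (x / 3) = x by ring] using h3 (x / 3)

/-- **`χ (n̄(s)) = 1`**. -/
theorem map_uniBar (s : ℝ) : χ (uniBar s) = 1 := by
  have key : ∀ y : ℝ, χ (uniBar (4 * y)) = χ (uniBar y) := fun y => by
    have h := congrArg χ (bst_mul_uniBar y)
    rw [map_mul, map_mul, mul_comm (χ (uniBar y))] at h
    exact mul_left_cancel h
  have h3 : ∀ y : ℝ, χ (uniBar (3 * y)) = 1 := fun y => by
    have e : uniBar (4 * y) = uniBar y * uniBar (3 * y) := by rw [uniBar_add]; ring_nf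
    have h := key y
    rw [e, map_mul] at h
    exact mul_left_cancel (h.trans (mul_one _).symm)
  simpa [show 3 * (s / 3) = s by ring] using h3 (s / 3)

end Char

/-! ## § 4 The compact torus elements `diag(z, 1, z̄)` and `diag(1, z, z̄)` -/

/-- (Ported verbatim from the HodgeCMPerL package; no docstring in the source.) -/
theorem torT_rel {z : ℂ} (hz : conj z * z = 1) : conj z * z - conj 0 * 0 = 1 := by
  rw [map_zero, mul_zero, sub_zero, hz]

/-- `diag(z, 1, z̄)` for `|z| = 1`. -/
def torT (z : ℂ) (hz : conj z * z = 1) : U21 := hyp z 0 (torT_rel hz)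

/-- (Ported verbatim from the HodgeCMPerL package; no docstring in the source.) -/
@[simp] theorem mat_torT (z : ℂ) (hz : conj z * z = 1) : mat (torT z hz) = hypMat z 0 := rfl

/-- (Ported verbatim from the HodgeCMPerL package; no docstring in the source.) -/
theorem torT_mul (z w : ℂ) (hz : conj z * z = 1) (hw : conj w * w = 1) :
    torT z hz * torT w hw = torT (z * w) (by rw [map_mul, mul_mul_mul_comm, hz, hw, mul_one]) :=
  U21_eq_of_mat_eq (by
    rw [mat_mul, mat_torT, mat_torT, mat_torT, hypMat_mul]
    exact hypMat_congr (by ring) (by ring))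

/-- (Ported verbatim from the HodgeCMPerL package; no docstring in the source.) -/
theorem torT_one : torT 1 (by rw [map_one, mul_one]) = 1 :=
  U21_eq_of_mat_eq (by rw [mat_torT, mat_one, hypMat_one])

/-- **the Cayley identity**: `diag(x − iy, 1, x + iy) = n(p) · n̄(y) · n(p)` whenever `p·y = x − 1` and `p·(x + 1) = −y`
(for `x² + y² = 1`, `y ≠ 0` take `p = (x − 1)/y`: the image of `rotation = (1 p; 0 1)(1 0; y 1)(1 p; 0 1)` in `SL₂(ℝ)`). -/
theorem torT_eq_uni_mul_uniBar_mul_uni (x y p : ℝ) (h : conj ((x : ℂ) - y * I) * ((x : ℂ) - y * I) = 1)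
    (hp1 : p * y = x - 1) (hp2 : p * (x + 1) = -y) :
    torT ((x : ℂ) - y * I) h = uni p * uniBar y * uni p := by
  have hp1' : (p : ℂ) * y = x - 1 := by exact_mod_cast hp1
  have hp2' : (p : ℂ) * (x + 1) = -y := by exact_mod_cast hp2
  symm
  refine U21_eq_of_mat_eq ?_
  rw [mat_mul, mat_mul, uni, uniBar, mat_hyp, mat_hyp, mat_torT, hypMat_mul, hypMat_mul]
  refine hypMat_congr ?_ ?_
  · linear_combination (norm := skip) (1 + I * p / 2) * hp1' + (I / 2) * hp2'
    ((try simp only [map_sub, map_neg, map_mul, map_div₀, map_one, map_ofNat, Complex.conj_I, Complex.conj_ofReal]); first | ring1 | (ring_nf; simp only [Complex.I_sq, Complex.I_pow_three]; ring1))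
  · linear_combination (norm := skip) (-(I * p / 2)) * hp1' + (-(I / 2)) * hp2'
    ((try simp only [map_add, map_sub, map_neg, map_mul, map_div₀, map_one, map_ofNat, Complex.conj_I, Complex.conj_ofReal]); first | ring1 | (ring_nf; simp only [Complex.I_pow_three]; ring1))

section Char

variable {M : Type*} [CommGroup M] (χ : U21 →* M)

/-- **`χ (diag(z, 1, z̄)) = 1`** for every `|z| = 1` and every homomorphism to a commutative group. -/
theorem map_torT (z : ℂ) (hz : conj z * z = 1) : χ (torT z hz) = 1 := by
  -- `|z| = 1` as a real identity
  have hn : z.re ^ 2 + z.im ^ 2 = 1 := by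
    have h1 : ((z.re ^ 2 + z.im ^ 2 : ℝ) : ℂ) = 1 := by
      rw [← hz, ← Complex.normSq_add_mul_I z.re z.im, Complex.normSq_eq_conj_mul_self, Complex.re_add_im]
    exact_mod_cast h1
  -- generic case `Im z ≠ 0`
  have hgen : ∀ w : ℂ, ∀ hw : conj w * w = 1, w.im ≠ 0 → χ (torT w hw) = 1 := by
    intro w hw hwi
    have hnw : w.re ^ 2 + w.im ^ 2 = 1 := by
      have h1 : ((w.re ^ 2 + w.im ^ 2 : ℝ) : ℂ) = 1 := by
        rw [← hw, ← Complex.normSq_add_mul_I w.re w.im, Complex.normSq_eq_conj_mul_self, Complex.re_add_im]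
      exact_mod_cast h1
    have hy : (-w.im) ≠ 0 := neg_ne_zero.mpr hwi
    have hw' : (w.re : ℂ) - ((-w.im : ℝ) : ℂ) * I = w := by
      apply Complex.ext <;> simp
    have key := torT_eq_uni_mul_uniBar_mul_uni w.re (-w.im) ((w.re - 1) / (-w.im)) (by rw [hw']; exact hw)
      (by field_simp) (by field_simp; nlinarith [hnw])
    have e : torT w hw = torT ((w.re : ℂ) - ((-w.im : ℝ) : ℂ) * I) (by rw [hw']; exact hw) := by
      simp only [hw']
    rw [e, key, map_mul, map_mul, map_uni, map_uniBar, mul_one, mul_one]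
  by_cases hzi : z.im ≠ 0
  · exact hgen z hz hzi
  · rw [not_not] at hzi
    have hre : z.re = 1 ∨ z.re = -1 := by
      rw [hzi] at hn
      have : (z.re - 1) * (z.re + 1) = 0 := by nlinarith [hn]
      rcases mul_eq_zero.mp this with h | h
      · exact Or.inl (by linarith)
      · exact Or.inr (by linarith)
    rcases hre with h1 | h1
    · have hz1 : z = 1 := Complex.ext (by simp [h1]) (by simp [hzi])
      subst hz1
      rw [torT_one, map_one]
    · have hz1 : z = -1 := Complex.ext (by simp [h1]) (by simp [hzi])
      subst hz1
      have hI : conj I * I = 1 := by rw [conj_I, neg_mul, I_mul_I, neg_neg]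
      have e : torT (-1) hz = torT I hI * torT I hI := by
        rw [torT_mul]
        exact U21_eq_of_mat_eq (by rw [mat_torT, mat_torT]; exact hypMat_congr (by rw [I_mul_I]) rfl)
      rw [e, map_mul, hgen I hI (by simp), mul_one]

end Char

/-- the coordinate swap `(0 1 0; 1 0 0; 0 0 1)`. -/
def swapMat : Matrix (Fin 3) (Fin 3) ℂ := !![0, 1, 0; 1, 0, 0; 0, 0, 1]

/-- (Ported verbatim from the HodgeCMPerL package; no docstring in the source.) -/
theorem swapMat_mem : swapMatᴴ * BallModel.J * swapMat = BallModel.J := by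
  ext i j
  fin_cases i <;> fin_cases j <;>
    simp [swapMat, BallModel.J, Matrix.mul_apply, Fin.sum_univ_three, Matrix.conjTranspose_apply, Matrix.diagonal_apply]

/-- the swap as an element of `U(2,1)`. -/
def swapU : U21 := mkU21 swapMat swapMat_mem

/-- (Ported verbatim from the HodgeCMPerL package; no docstring in the source.) -/
theorem swapU_mul_self : swapU * swapU = 1 :=
  U21_eq_of_mat_eq (by
    rw [mat_mul, swapU, mat_mkU21, mat_one]
    ext i j
    fin_cases i <;> fin_cases j <;> simp [swapMat, Matrix.mul_apply, Fin.sum_univ_three])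

/-- `diag(1, z, z̄)` for `|z| = 1` (the swap-conjugate of `torT z`). -/
def torT' (z : ℂ) (hz : conj z * z = 1) : U21 := swapU * torT z hz * swapU

/-- (Ported verbatim from the HodgeCMPerL package; no docstring in the source.) -/
theorem mat_torT' (z : ℂ) (hz : conj z * z = 1) : mat (torT' z hz) = !![1, 0, 0; 0, z, 0; 0, 0, conj z] := by
  rw [torT', mat_mul, mat_mul, mat_torT, swapU, mat_mkU21]
  ext i j
  fin_cases i <;> fin_cases j <;> simp [swapMat, hypMat, Matrix.mul_apply, Fin.sum_univ_three]

section Char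

variable {M : Type*} [CommGroup M] (χ : U21 →* M)

/-- **`χ (diag(1, z, z̄)) = 1`**. -/
theorem map_torT' (z : ℂ) (hz : conj z * z = 1) : χ (torT' z hz) = 1 := by
  rw [torT', map_mul, map_mul, map_torT, mul_one, ← map_mul, swapU_mul_self, map_one]

end Char

/-! ## § 5 On `K = U(2) × U(1)`: every abelian character is a function of `det` -/

/-- `diag(p, q) ∈ U(2)` for `|p| = |q| = 1`. -/
def diag2U (p q : ℂ) (hp : conj p * p = 1) (hq : conj q * q = 1) : Matrix.unitaryGroup (Fin 2) ℂ :=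
  ⟨!![p, 0; 0, q], by
    rw [Matrix.mem_unitaryGroup_iff']
    ext i j
    fin_cases i <;> fin_cases j <;> simp [Matrix.mul_apply, Fin.sum_univ_two, Matrix.star_apply, hp, hq]⟩

/-- (Ported verbatim from the HodgeCMPerL package; no docstring in the source.) -/
@[simp] theorem coe_diag2U (p q : ℂ) (hp : conj p * p = 1) (hq : conj q * q = 1) :
    (diag2U p q hp hq : Matrix (Fin 2) (Fin 2) ℂ) = !![p, 0; 0, q] := rfl

/-- the real rotation `(x −y; y x) ∈ U(2)`, `x² + y² = 1`. -/
def rotU (x y : ℝ) (h : x ^ 2 + y ^ 2 = 1) : Matrix.unitaryGroup (Fin 2) ℂ :=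
  ⟨!![(x : ℂ), -y; y, x], by
    have hC : (x : ℂ) ^ 2 + (y : ℂ) ^ 2 = 1 := by exact_mod_cast h
    rw [Matrix.mem_unitaryGroup_iff']
    ext i j
    fin_cases i <;> fin_cases j <;> simp [Matrix.mul_apply, Fin.sum_univ_two, Matrix.star_apply] <;>
      first | linear_combination hC | ring1⟩

/-- (Ported verbatim from the HodgeCMPerL package; no docstring in the source.) -/
@[simp] theorem coe_rotU (x y : ℝ) (h : x ^ 2 + y ^ 2 = 1) : (rotU x y h : Matrix (Fin 2) (Fin 2) ℂ) = !![(x : ℂ), -y; y, x] := rfl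

/-- the fixed unitary `((1+i)/2 (1+i)/2; (1−i)/2 (−1+i)/2)` diagonalising every real rotation. -/
def cayU : Matrix.unitaryGroup (Fin 2) ℂ :=
  ⟨!![(1 + I) / 2, (1 + I) / 2; (1 - I) / 2, (-1 + I) / 2], by
    rw [Matrix.mem_unitaryGroup_iff']
    ext i j
    fin_cases i <;> fin_cases j <;> simp [Matrix.mul_apply, Fin.sum_univ_two, Matrix.star_apply] <;> ((try simp only [map_ofNat]); first | ring1 | (ring_nf; simp only [Complex.I_sq]; ring1))⟩

/-- (Ported verbatim from the HodgeCMPerL package; no docstring in the source.) -/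
@[simp] theorem coe_cayU : (cayU : Matrix (Fin 2) (Fin 2) ℂ) = !![(1 + I) / 2, (1 + I) / 2; (1 - I) / 2, (-1 + I) / 2] := rfl

/-- `R(x, y) · c = c · diag(x + iy, x − iy)`. -/
theorem rotU_mul_cayU (x y : ℝ) (h : x ^ 2 + y ^ 2 = 1) (hz : conj ((x : ℂ) + y * I) * ((x : ℂ) + y * I) = 1)
    (hz' : conj ((x : ℂ) - y * I) * ((x : ℂ) - y * I) = 1) :
    rotU x y h * cayU = cayU * diag2U ((x : ℂ) + y * I) ((x : ℂ) - y * I) hz hz' := by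
  apply Subtype.ext
  change (rotU x y h : Matrix (Fin 2) (Fin 2) ℂ) * (cayU : Matrix (Fin 2) (Fin 2) ℂ) =
    (cayU : Matrix (Fin 2) (Fin 2) ℂ) * (diag2U _ _ hz hz' : Matrix (Fin 2) (Fin 2) ℂ)
  rw [coe_rotU, coe_cayU, coe_diag2U]
  ext i j
  fin_cases i <;> fin_cases j <;> simp [Matrix.mul_apply, Fin.sum_univ_two] <;> (first | ring1 | (ring_nf; simp only [Complex.I_sq]; ring1))

/-- a unit complex number as an element of `unitary ℂ`. -/
def unitOf (d : ℂ) (hd : conj d * d = 1) : unitary ℂ :=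
  ⟨d, Unitary.mem_iff.mpr ⟨hd, by rw [mul_comm]; exact hd⟩⟩

/-- (Ported verbatim from the HodgeCMPerL package; no docstring in the source.) -/
@[simp] theorem coe_unitOf (d : ℂ) (hd : conj d * d = 1) : (unitOf d hd : ℂ) = d := rfl

/-- (Ported verbatim from the HodgeCMPerL package; no docstring in the source.) -/
theorem conj_mul_self_of_unitary (u : unitary ℂ) : conj (u : ℂ) * u = 1 := Unitary.coe_star_mul_self u


-- port_pkg: scope closed for this part
end HodgeCM.Model.U21Char
end
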